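import Summits.QuantumFields.BalabanUV.T4Continuum.Support.B16HistoryTowerExtractionEnd
import Summits.QuantumFields.BalabanUV.T4Continuum.Support.B16HistoryTowerExtractionEnd3

/-!
# BalabanUVNodes ∕ N20 knit — node N20 = spine estimate NE7b (`T4WeightBudget.RelWeightBound`) BY NAME, at EXACT carriers,
# from the two runs' extraction laws, and at the (α) road's tower records (Track A, DAG node N20; cluster K5 «SpineMatching»)

HONEST FRAMING.  Count-neutral kernel bookkeeping BY NAME over LANDED hypothesis shapes of the cell `pub-balaban` (row NE7b,
owner lineage `t4-ne7b-p1`, typists leaf-03 ∕ leaf-06 ∕ `pub-balaban-gaps` seat ne6); NOT a node discharge (YM-PLAN §1: no NODE 00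
stage pins the term-class carriers of N19∕N20∕N21; the (α)-instance — Bałaban's K-step 𝐓∘𝐑 term recursion [Balaban1989LargeFieldII]
(1.72) with the per-operation factors (1.79)–(1.89) as binders, as a Lean object — is 0∕1 and its commissioning «NC-NE7b-α» is UNRULED).
NE7b is the cell's OWN estimate: NOT PRINTED in [Bałaban 1983–89], NOT PROVED.  Its printed MODEL is [King1986] (3.10)–(3.11) p. 656
(abelian Higgs₂,₃: the large-field complement of the matched part is bounded by a WEIGHT carrying a positive power of the lattice
spacing — exactly what d = 4 lacks, [Balaban1989LargeFieldI] p. 175).  One finite four-torus programme at fixed ε; nothing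
continuum ∕ ℝ⁴ ∕ OS ∕ mass-gap ∕ Clay.  0 `sorry`, 0 `def`, 0 `structure`, standard axioms.

THE NODE.  Statement of record `Literature.….T4WeightBudget.RelWeightBound l₀ T A B Bad W` (T4WeightBudget.lean :117): per cutoff `K`
and source `|t| ≤ l₀`, in EACH of the two runs (term weights `A K t`, `B K t` on ONE class family `T K`) the bad class `Bad K t ⊆ T K`
(terms carrying live large-field structure older than `K − j⋆(K)`) has RELATIVE weight `≤ W K`, with `0 ≤ W K < 1` and `Σ_K W K < ∞`.
Consumer: field `weight` of `T4MatchingAssembly.HybridNE7` (Q8 naming of record, dagwriter g73: N20 ↔ `HybridNE7.weight`; the road of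
record into N27 is the pin-free assembly `SpineDatum` = N20 ∧ N21 ∧ N19 ∧ `W + Wsh < 1` ∧ `Summable δ` ∧ E1∕E2 over EXISTENTIAL carriers;
witness roads = producers, none privileged).  Cluster K5's stub shape (dagwriter g74 `UVSplit` §K5): `S_N20 SRec := ∀ F D g₀ os S,
SRec F D g₀ os S → RelWeightBound S.l₀ S.T S.A S.B S.Bad S.W` — the carriers `S.Bad`, `S.W` VERBATIM (no threshold, no indicator).

IN-EDGES OF N20 AND WHERE THEY ENTER (YM-PLAN v0.12.15 §2c row NE7b; BALABAN-GAPS v1.0 §C row NE7b; `ne/NE7b.md` v1.34 §3):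
* N13 ([B16] (1.79)–(1.89) pp. 383–387 — the inductive bounds of the large-field factors, the renewal∕merger inequalities (1.85)–(1.88) and
  the fundamental inequality (1.89)): they are the KIND of the per-pinned-genealogy RELATIVE display `extract` of
  `NE7b.PinnedExtraction.ExtractionLaws` (owner ruling W-ne7bp1-g103-1: the (α) road is RE-CUT there) — binders `hA`, `hB` of §1, record
  rows `extractA ∕ extractB` of §2–§3; one step deeper (§3, second half) that display is DERIVED from `NE7b.LocalConditionalStability.
  LocCondStability` per pinned event (`B16HistoryTowerExtractionEnd3.extractA_of_LCS ∕ extractB_of_LCS`) — print's KIND ([Balaban1989LargeFieldI]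
  (0.3)–(0.5) pp. 176–177, [Balaban1989LargeFieldII] p. 383), NOT print's statement;
* N12 ([B15] p. 177 (i)∕(ii) — the class of components the 𝐑-operation renormalises, i.e. the event-free WINDOW; with [B16] p. 387 «K ≤ K₂ +
  n₁ + R_{j+1}»): the cell's COUNT in relative currency `Σ_{bad keys} q K k ≤ V·r^{K − j⋆(K)}` (`T4WeightBudget` §3's renewal arithmetic;
  `T4RenewalChains.half_le_sub_jhalf` for `j⋆ = ⌊K∕2⌋`) — binders `hWA ∕ hWB` (§1), record rows `countA ∕ countB` (§2), binders `countA ∕ countB`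
  at the LCS-derived quotients (§3);
* N16 (NE3's species F∞): no row of the records below reads it; it would enter through an INHABITANT of the residual `LocCondStability`
  (β-uniformity via constrained-minimiser backgrounds — the owner's sup road `Spine/NE7b/Sup*`) and through NE7c's shells — recorded, not used;
* NODE 00 ∕ (A1c): the carriers (term classes, weights, bad classes) — here the tower records' `HIndex.termSet (skelFam T p₀)`, M2-A's
  `Repr172R.weight`, `B16HistoryIndexedTrunc.weightB`, the budget's saturated bad set `badOfClass …`; none pinned by NODE 00.
WHAT HAS NO TREE PRODUCER (reported to dag-lead for n20-b): an INHABITANT, for Bałaban's tower, of the records' rows of Bałaban's KIND —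
`extractA ∕ extractB` (§2) resp. `lcsA ∕ lcsB` (+ the by-definition `pwA ∕ pwB`, §3) — and of the cell's count (`countA ∕ countB` resp. the §3
binders; on the IR-104-2 road the tree DERIVES the count from the price sentences `ledgerA ∕ ledgerB` inside the pinned `_rel` END
`NE7b.RealisedPinnedRelPDWTL`, jointly with N19∕N21 — not at the `RelWeightBound` level); and the tower object itself (owner WALL
`ROW-NE7b-STATE.md` v1.76 §3).  Everything between those rows and `RelWeightBound` is kernel, BY NAME, below.

CONTENTS.  §1 (carrier-abstract, EXACT carriers) `relWeightBound_mono_weight` — a producer's weight may be replaced by any pinned summable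
majorant `< 1` (record-matching bookkeeping); `relWeightBound_of_extractionLaws` — two runs' `ExtractionLaws` over the SAME bad classes + quotient
totals `≤ W K` + `W K < 1` + `Σ W < ∞` ⇒ `RelWeightBound l₀ T A B Bad W` VERBATIM (the tree's `PinnedExtraction.relWeightBound_of_extraction`
concludes the threshold-emptied form) = the content a record predicate must supply for `S_N20`; `relWeightBound_of_extractionLaws_majorant`
(two-rate majorant); `exists_relWeightBound_shifted_of_extraction_majorant` (no `< 1` asked: SOME origin shift, exact carriers).  §2
`relWeightBound_of_towerExtraction_shifted` — N20 BY NAME at the record `TowerExtractionDataLWR` of the (α) road RE-CUT (IR-103-1): `∃ K₁ ≥ Sd.K₀`,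
`RelWeightBound` at the `K₁`-SHIFTED tower carriers with the budget's own bad set and the weight `V·rq^{(K₁+K) − jhalf (K₁+K)}` VERBATIM,
reading ONLY N20's rows (`B16HistoryTowerExtractionEnd.relWeightBound_of_towerExtraction` ∘ `CountThresholdExit.relWeightBound_shift_of_eventually`;
the seam `hybridNE7_of_towerExtraction` gives it bundled with `shell`∕`budget`∕rates after a second shift).  §3 `extractionLawsA_priced ∕
extractionLawsB_priced` (the IR-103-2 record's displays ARE `ExtractionLaws`), `relWeightBound_of_towerExtractionPriced_count` (that record + a
DISPLAYED count ⇒ N20 at shifted carriers) and `relWeightBound_of_towerExtractionStep_count` — one step deeper, ne6's IR-104-2 record through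
`toPriced`: N20 ⇐ {`LocCondStability` per pinned event, step-kernel identities, key-pattern readings} + {the count at the derived quotients
`exp Σ_{j<K} (b − a)`}.

Sources: T. Bałaban, CMP **122** (1989) 175–202 [Balaban1989LargeFieldI] p. 175, p. 177 (i)∕(ii), (0.3)–(0.5) pp. 176–177; CMP **122** (1989)
355–392 [Balaban1989LargeFieldII] (1.72) p. 379, (1.79)–(1.89) pp. 383–387; C. King, CMP **102** (1986) [King1986] (3.10)–(3.11) p. 656.
Nothing here is a claim about the Yang–Mills mass gap.
-/

open Finset MeasureTheory
open Literature.MathematicalPhysics.QuantumFieldTheory.Balaban1983to89 T4PersistenceDictionary T4PersistentHistoryCount T4PrintedShapeBanking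
open T4WeightBudget T4LiveClassFibration T4IndicatorShell T4MatchingAssembly T4MatchingClosure T4MatchingClosureSocket T4Continuum T4RenewalChains
open Summit.QuantumFields.BalabanUV.T4Continuum.CountSeamJunction Summit.QuantumFields.BalabanUV.T4Continuum.HistoryFlow
open Summit.QuantumFields.BalabanUV.T4Continuum.HistoryConstants
open Summit.QuantumFields.BalabanUV.T4Continuum.HistorySocketTH Summit.QuantumFields.BalabanUV.T4Continuum.HistoryAssemblyTerms
open Summit.QuantumFields.BalabanUV.T4Continuum.HistoryAssemblyMult Summit.QuantumFields.BalabanUV.T4Continuum.HistoryAssemblyMultKey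
open Summit.QuantumFields.BalabanUV.T4Continuum.HistoryRealiseCellsRunApexT3b Summit.QuantumFields.BalabanUV.T4Continuum.HistoryGenealogyRealise
open Summit.QuantumFields.BalabanUV.T4Continuum.HistoryGenealogyInstantiate Summit.QuantumFields.BalabanUV.T4Continuum.B16HistoryIndexedRepr
open Summit.QuantumFields.BalabanUV.T4Continuum.B16HistoryIndexedTrunc Summit.QuantumFields.BalabanUV.T4Continuum.HistoryRealiseCellsRunAssemblyWTVSData
open Summit.QuantumFields.BalabanUV.T4Continuum.B16HistoryReprChain Summit.QuantumFields.BalabanUV.T4Continuum.B16HistoryReprInstance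
open Summit.QuantumFields.BalabanUV.T4Continuum.NE7b.PinnedExtraction
open Summit.QuantumFields.BalabanUV.T4Continuum.B16HistoryTowerExtractionDataLWR
open Summit.QuantumFields.BalabanUV.T4Continuum.B16HistoryTowerExtractionEnd
open Summit.QuantumFields.BalabanUV.T4Continuum.B16HistoryTowerExtractionPricedDataLWR
open Summit.QuantumFields.BalabanUV.T4Continuum.B16HistoryTowerExtractionStepDataLWR
open Summit.QuantumFields.BalabanUV.T4Continuum.B16HistoryTowerExtractionEnd3 (toPriced)
open Summit.QuantumFields.BalabanUV.T4Continuum.CountThresholdExit (relWeightBound_shift_of_eventually)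

noncomputable section

namespace Summit.QuantumFields.YangMills.BalabanUVNodes.N20Knit

set_option synthInstance.maxSize 1024

/-! ## §1 Carrier-abstract, EXACT carriers: what a record predicate must supply for `S_N20` -/

section Abstract

variable {ι α α' : Type*} {l₀ : ℝ} {T : ℕ → Finset ι} {A B : ℕ → ℝ → ι → ℝ} {Bad : ℕ → ℝ → Finset ι}
  {X : ℕ → Finset α} {Badx : ℕ → α → Finset ι} {q : ℕ → α → ℝ}
  {X' : ℕ → Finset α'} {Badx' : ℕ → α' → Finset ι} {q' : ℕ → α' → ℝ} {W W' : ℕ → ℝ}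

/-- **`RelWeightBound` is monotone in its weight**: a producer's weight sequence `W` may be replaced by any pinned majorant `W′ ≥ W`
that is still `< 1` and summable (nonnegative term weights on the classes) — the bookkeeping by which a record predicate's pinned
`S.W` is matched to the weight a witness road delivers. [folklore] -/
theorem relWeightBound_mono_weight (h : RelWeightBound l₀ T A B Bad W) (hle : ∀ K, W K ≤ W' K) (h1 : ∀ K, W' K < 1)
    (hs : Summable W') (hA : ∀ K t, |t| ≤ l₀ → ∀ τ ∈ T K, 0 ≤ A K t τ) (hB : ∀ K t, |t| ≤ l₀ → ∀ τ ∈ T K, 0 ≤ B K t τ) :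
    RelWeightBound l₀ T A B Bad W' where
  bad_subset := h.bad_subset
  nonneg K := (h.nonneg K).trans (hle K)
  lt_one := h1
  summable := hs
  bad_left K t ht := (h.bad_left K t ht).trans (mul_le_mul_of_nonneg_right (hle K) (Finset.sum_nonneg (hA K t ht)))
  bad_right K t ht := (h.bad_right K t ht).trans (mul_le_mul_of_nonneg_right (hle K) (Finset.sum_nonneg (hB K t ht)))

/-- **N20 AT EXACT CARRIERS FROM THE TWO RUNS' EXTRACTION LAWS** (the content of the K5 stub `S_N20`).  Run A's and run B's
`PinnedExtraction.ExtractionLaws` over the SAME source-free term classes `T K` and bad classes `Bad K t` (run B's weights after node O's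
partial summation onto run A's index; pinned classes `X ∕ X′`, sub-classes `Badx ∕ Badx′`, source-uniform quotients `q ∕ q′` — the H3^NE7b
display of [Balaban1989LargeFieldII] (1.79)–(1.89)'s KIND per pinned old genealogy, RELATIVE to the same run's full sum), nonnegative
weights, quotient totals `Σ_x q K x ≤ W K`, `Σ_x q′ K x ≤ W K` (the cell's count), `W K < 1` for EVERY `K` and `Σ W < ∞` give
`RelWeightBound l₀ T A B Bad W` with `Bad` and `W` VERBATIM — no threshold, no indicator (`PinnedExtraction.relWeightBound_of_extraction`
is the threshold-emptied twin).  Every analytic input is a hypothesis. [folklore] -/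
theorem relWeightBound_of_extractionLaws (hA : ExtractionLaws l₀ T A Bad X Badx q) (hB : ExtractionLaws l₀ T B Bad X' Badx' q')
    (hA0 : ∀ K t, |t| ≤ l₀ → ∀ τ, 0 ≤ A K t τ) (hB0 : ∀ K t, |t| ≤ l₀ → ∀ τ, 0 ≤ B K t τ)
    (hWA : ∀ K, ∑ x ∈ X K, q K x ≤ W K) (hWB : ∀ K, ∑ x ∈ X' K, q' K x ≤ W K) (h1 : ∀ K, W K < 1) (hs : Summable W) :
    RelWeightBound l₀ T A B Bad W where
  bad_subset := hA.bad_subset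
  nonneg K := (hA.sum_q_nonneg K).trans (hWA K)
  lt_one := h1
  summable := hs
  bad_left K t ht := (hA.bad_le hA0 K t ht).trans
    (mul_le_mul_of_nonneg_right (hWA K) (Finset.sum_nonneg fun τ _ => hA0 K t ht τ))
  bad_right K t ht := (hB.bad_le hB0 K t ht).trans
    (mul_le_mul_of_nonneg_right (hWB K) (Finset.sum_nonneg fun τ _ => hB0 K t ht τ))

/-- **… with the two-rate majorant as the weight**: quotient totals `≤ V·r^{K − j⋆(K)}` in both runs (`0 < r < 1`, `0 ≤ V`, a positive
fraction `c·K ≤ K − j⋆(K)` of old steps — `T4WeightBudget.summable_weightMajorant`) and `V·r^{K − j⋆(K)} < 1` at every `K` give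
`RelWeightBound l₀ T A B Bad (K ↦ V·r^{K − j⋆(K)})` at exact carriers. [folklore] -/
theorem relWeightBound_of_extractionLaws_majorant {r V c : ℝ} {jstar : ℕ → ℕ}
    (hA : ExtractionLaws l₀ T A Bad X Badx q) (hB : ExtractionLaws l₀ T B Bad X' Badx' q')
    (hA0 : ∀ K t, |t| ≤ l₀ → ∀ τ, 0 ≤ A K t τ) (hB0 : ∀ K t, |t| ≤ l₀ → ∀ τ, 0 ≤ B K t τ)
    (h0 : 0 < r) (hr1 : r < 1) (hV : 0 ≤ V) (hc : 0 < c) (hfrac : ∀ K : ℕ, c * K ≤ ((K - jstar K : ℕ) : ℝ))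
    (hmajA : ∀ K, ∑ x ∈ X K, q K x ≤ V * r ^ (K - jstar K)) (hmajB : ∀ K, ∑ x ∈ X' K, q' K x ≤ V * r ^ (K - jstar K))
    (hlt : ∀ K, V * r ^ (K - jstar K) < 1) :
    RelWeightBound l₀ T A B Bad fun K => V * r ^ (K - jstar K) :=
  relWeightBound_of_extractionLaws hA hB hA0 hB0 hmajA hmajB hlt (summable_weightMajorant h0 hr1 hV hc hfrac)

/-- **… and with NO `< 1` asked: SOME origin shift, exact carriers.**  Under the two-rate majorant the weight is eventually `< 1`, so for
some `K₁` the `K₁`-SHIFTED families `K ↦ T (K₁ + K)`, … carry `RelWeightBound` with the shifted bad classes and weights VERBATIM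
(`PinnedExtraction.exists_relWeightBound_of_extraction_majorant`, then `CountThresholdExit.relWeightBound_shift_of_eventually`) — the currency of
the `SpineDatum` conjunct N20 (free offset `K₀`). [folklore] -/
theorem exists_relWeightBound_shifted_of_extraction_majorant {r V c : ℝ} {jstar : ℕ → ℕ}
    (hA : ExtractionLaws l₀ T A Bad X Badx q) (hB : ExtractionLaws l₀ T B Bad X' Badx' q')
    (hA0 : ∀ K t, |t| ≤ l₀ → ∀ τ, 0 ≤ A K t τ) (hB0 : ∀ K t, |t| ≤ l₀ → ∀ τ, 0 ≤ B K t τ)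
    (h0 : 0 < r) (hr1 : r < 1) (hV : 0 ≤ V) (hc : 0 < c) (hfrac : ∀ K : ℕ, c * K ≤ ((K - jstar K : ℕ) : ℝ))
    (hmajA : ∀ K, ∑ x ∈ X K, q K x ≤ V * r ^ (K - jstar K)) (hmajB : ∀ K, ∑ x ∈ X' K, q' K x ≤ V * r ^ (K - jstar K)) :
    ∃ K₁ : ℕ, RelWeightBound l₀ (fun K => T (K₁ + K)) (fun K => A (K₁ + K)) (fun K => B (K₁ + K)) (fun K => Bad (K₁ + K))
      fun K => V * r ^ (K₁ + K - jstar (K₁ + K)) := by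
  obtain ⟨K₀, h⟩ := exists_relWeightBound_of_extraction_majorant hA hB hA0 hB0 h0 hr1 hV hc hfrac hmajA hmajB
  obtain ⟨K₁, -, h1⟩ := relWeightBound_shift_of_eventually (K₀ := K₀) ⟨K₀, le_rfl, h⟩
  exact ⟨K₁, h1⟩

end Abstract

/-! ## §2 N20 BY NAME at the record of the (α) road RE-CUT (IR-103-1), exact carriers at a shifted origin, N20's rows only -/

section Tower

variable {F : T4Family} {G : Type*} [GaugeGroup G] [MeasurableSpace G] [HaarData G]
  {D : FiniteEpsData F G} {C : T4PrintedShapeBanking.Consts} {O : PrintedO1s} {θv : ℝ} {rr d n : ℕ} {hn : 0 < n}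
  {g₀ : ℕ → ℝ} {os : List (ULoop F)} {cΛ M Φ β₀ : ℝ} {p₁ η η' κ κ₂ κᵥ : ℕ}
  {P : Type} [DecidableEq P] {X : ℕ → ℕ → Type} {𝒢 : (K j : ℕ) → GoodClass (X K j)}
  [∀ K, MeasurableSpace (X K K)] {μ : (K : ℕ) → Measure (X K K)} [∀ K, IsFiniteMeasure (μ K)]

/-- **N20 · NE7b BY NAME AT THE TOWER RECORD OF THE RE-CUT (α) ROAD, IN `SpineDatum` CURRENCY.**  For a record
`Sd : TowerExtractionDataLWR …` (for the datum `D`, the tuned bare sequence `g₀` and the loop string `os`; its rows of Bałaban's KIND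
`extractA ∕ extractB` — in-edge N13's (1.79)–(1.89) read per pinned old genealogy, RELATIVE — and the cell's `countA ∕ countB` — the
renewal count on in-edge N12's window — are HYPOTHESES carried by the record; no NE7c `shell`, NE7 `budget` or rate row is read): for
some `K₁ ≥ Sd.K₀` the `K₁`-SHIFTED tower families — term classes `HIndex.termSet (skelFam Sd.T Sd.p₀) (K₁ + K)`, run A's M2-A weights,
run B's weights `weightB … Sd.trunc` after node O's partial summation, the budget's OWN saturated bad set and the weight
`Sd.V · Sd.rq ^ ((K₁ + K) − jhalf (K₁ + K))`, all VERBATIM — satisfy `T4WeightBudget.RelWeightBound Sd.l₀ …`.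
Proof: `relWeightBound_of_towerExtraction` (eventual form) ∘ `relWeightBound_shift_of_eventually`. [folklore] -/
theorem relWeightBound_of_towerExtraction_shifted
    (Sd : TowerExtractionDataLWR D C O θv rr d n hn g₀ os cΛ M Φ β₀ p₁ η η' κ κ₂ κᵥ P X 𝒢 μ) :
    ∃ K₁, Sd.K₀ ≤ K₁ ∧ RelWeightBound Sd.l₀ (fun K => HIndex.termSet (skelFam Sd.T Sd.p₀) (K₁ + K))
      (fun _ t => Repr172R.weight μ (reprFam Sd.T Sd.p₀ Sd.ρ₀ Sd.hρ₀ Sd.h0 (fun _ _ => 1) (fun _ _ => one_pos)) t)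
      (fun K => weightB μ (reprFam Sd.T Sd.p₀ Sd.ρ₀ Sd.hρ₀ Sd.h0 (fun _ _ => 1) (fun _ _ => one_pos)) Sd.trunc (K₁ + K))
      (fun K t => badOfClass (bstrOf Prod.fst (memA n F.L (Sd.𝒮.reading Sd.T Sd.p₀))) (HIndex.termSet (skelFam Sd.T Sd.p₀))
          (fun K _ => badClasses Prod.fst (memA n F.L (Sd.𝒮.reading Sd.T Sd.p₀)) jhalf (HIndex.termSet (skelFam Sd.T Sd.p₀)) K)
          (K₁ + K) t)
      (fun K => Sd.V * Sd.rq ^ (K₁ + K - jhalf (K₁ + K))) :=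
  relWeightBound_shift_of_eventually (relWeightBound_of_towerExtraction Sd)

end Tower

/-! ## §3 One step deeper: the IR-103-2 ∕ IR-104-2 records — H3^NE7b's display DERIVED from local conditional stability, the count displayed -/

section Priced

variable {F : T4Family} {G : Type*} [GaugeGroup G] [MeasurableSpace G] [HaarData G]
  {D : FiniteEpsData F G} {C : T4PrintedShapeBanking.Consts} {O : PrintedO1s} {θv : ℝ} {rr d n : ℕ} {hn : 0 < n}
  {g₀ : ℕ → ℝ} {os : List (ULoop F)} {cΛ M Φ b₀ : ℝ} {p₁ η η' κ κ₂ κᵥ : ℕ}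
  {P : Type} [DecidableEq P] {X : ℕ → ℕ → Type} {𝒢 : (K j : ℕ) → GoodClass (X K j)}
  [∀ K, MeasurableSpace (X K K)] {μ : (K : ℕ) → Measure (X K K)} [∀ K, IsFiniteMeasure (μ K)]

/-- **RUN A's EXTRACTION LAWS AT THE IR-103-2 RECORD** (`TowerExtractionPricedDataLWR`, the «count DERIVED» record of END2; its display
`extractA` has the same binder shape as IR-103-1's): term sets `T†`, M2-A's weights, the budget's saturated bad set and the bad keys both
EMPTIED below `Sp.K₀`, sub-classes the key fibres, quotients `Sp.qA`; cover by `B16HistoryTowerExtractionEnd.exists_mem_badGMems_mem_fibre`.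
(Verbatim the sibling `B16HistoryTowerExtractionEnd.extractionLawsA` on the sibling record.) [folklore] -/
theorem extractionLawsA_priced (Sp : TowerExtractionPricedDataLWR D C O θv rr d n hn g₀ os cΛ M Φ b₀ p₁ η η' κ κ₂ κᵥ P X 𝒢 μ) :
    ExtractionLaws Sp.l₀ (HIndex.termSet (skelFam Sp.T Sp.p₀))
      (fun _ t => Repr172R.weight μ (reprFam Sp.T Sp.p₀ Sp.ρ₀ Sp.hρ₀ Sp.h0 (fun _ _ => 1) (fun _ _ => one_pos)) t)
      (fun K t => if Sp.K₀ ≤ K then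
        badOfClass (bstrOf Prod.fst (memA n F.L (Sp.𝒮.reading Sp.T Sp.p₀))) (HIndex.termSet (skelFam Sp.T Sp.p₀))
          (fun K _ => badClasses Prod.fst (memA n F.L (Sp.𝒮.reading Sp.T Sp.p₀)) jhalf (HIndex.termSet (skelFam Sp.T Sp.p₀)) K) K t
        else ∅)
      (fun K => if Sp.K₀ ≤ K then
        badGMems (memA n F.L (Sp.𝒮.reading Sp.T Sp.p₀)) jhalf (HIndex.termSet (skelFam Sp.T Sp.p₀))
          (kmemA n F.L hn (lt_of_lt_of_le (by norm_num) (two_le_L F)) (Sp.𝒮.reading Sp.T Sp.p₀)) K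
        else ∅)
      (fun K k => fibre (kmemA n F.L hn (lt_of_lt_of_le (by norm_num) (two_le_L F)) (Sp.𝒮.reading Sp.T Sp.p₀))
        (HIndex.termSet (skelFam Sp.T Sp.p₀)) K k)
      Sp.qA where
  bad_subset K t _ := by
    by_cases hK : Sp.K₀ ≤ K
    · simp only [if_pos hK]; exact badOfClass_subset K t
    · simp only [if_neg hK]; exact Finset.empty_subset _
  cover K t _ τ hτ := by
    by_cases hK : Sp.K₀ ≤ K
    · simp only [if_pos hK] at hτ ⊢
      exact exists_mem_badGMems_mem_fibre hτ
    · simp only [if_neg hK] at hτ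
      exact absurd hτ (Finset.notMem_empty τ)
  q_nonneg K k hk := by
    by_cases hK : Sp.K₀ ≤ K
    · simp only [if_pos hK] at hk; exact Sp.qA_nonneg K hK k hk
    · simp only [if_neg hK] at hk; exact absurd hk (Finset.notMem_empty k)
  extract K t ht k hk := by
    by_cases hK : Sp.K₀ ≤ K
    · simp only [if_pos hK] at hk; exact Sp.extractA K t ht hK k hk
    · simp only [if_neg hK] at hk; exact absurd hk (Finset.notMem_empty k)

/-- **RUN B's EXTRACTION LAWS AT THE IR-103-2 RECORD, AT RUN A's INDEX** (weights `weightB μ RA Sp.trunc`, quotients `Sp.qB`; the display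
`Sp.extractB` moved to run A's index by `B16HistoryIndexedTrunc.sum_fibre_aggW_eq` ∕ `sum_aggW_eq (Sp.htr K hK)` — verbatim the sibling
`B16HistoryTowerExtractionEnd.extractionLawsB`). [folklore] -/
theorem extractionLawsB_priced (Sp : TowerExtractionPricedDataLWR D C O θv rr d n hn g₀ os cΛ M Φ b₀ p₁ η η' κ κ₂ κᵥ P X 𝒢 μ) :
    ExtractionLaws Sp.l₀ (HIndex.termSet (skelFam Sp.T Sp.p₀))
      (weightB μ (reprFam Sp.T Sp.p₀ Sp.ρ₀ Sp.hρ₀ Sp.h0 (fun _ _ => 1) (fun _ _ => one_pos)) Sp.trunc)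
      (fun K t => if Sp.K₀ ≤ K then
        badOfClass (bstrOf Prod.fst (memA n F.L (Sp.𝒮.reading Sp.T Sp.p₀))) (HIndex.termSet (skelFam Sp.T Sp.p₀))
          (fun K _ => badClasses Prod.fst (memA n F.L (Sp.𝒮.reading Sp.T Sp.p₀)) jhalf (HIndex.termSet (skelFam Sp.T Sp.p₀)) K) K t
        else ∅)
      (fun K => if Sp.K₀ ≤ K then
        badGMems (memA n F.L (Sp.𝒮.reading Sp.T Sp.p₀)) jhalf (HIndex.termSet (skelFam Sp.T Sp.p₀))
          (kmemA n F.L hn (lt_of_lt_of_le (by norm_num) (two_le_L F)) (Sp.𝒮.reading Sp.T Sp.p₀)) K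
        else ∅)
      (fun K k => fibre (kmemA n F.L hn (lt_of_lt_of_le (by norm_num) (two_le_L F)) (Sp.𝒮.reading Sp.T Sp.p₀))
        (HIndex.termSet (skelFam Sp.T Sp.p₀)) K k)
      Sp.qB where
  bad_subset K t _ := by
    by_cases hK : Sp.K₀ ≤ K
    · simp only [if_pos hK]; exact badOfClass_subset K t
    · simp only [if_neg hK]; exact Finset.empty_subset _
  cover K t _ τ hτ := by
    by_cases hK : Sp.K₀ ≤ K
    · simp only [if_pos hK] at hτ ⊢
      exact exists_mem_badGMems_mem_fibre hτ
    · simp only [if_neg hK] at hτ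
      exact absurd hτ (Finset.notMem_empty τ)
  q_nonneg K k hk := by
    by_cases hK : Sp.K₀ ≤ K
    · simp only [if_pos hK] at hk; exact Sp.qB_nonneg K hK k hk
    · simp only [if_neg hK] at hk; exact absurd hk (Finset.notMem_empty k)
  extract K t ht k hk := by
    by_cases hK : Sp.K₀ ≤ K
    · simp only [if_pos hK] at hk
      rw [weightB, sum_fibre_aggW_eq,
        sum_aggW_eq (S := fun K => HIndex.termSet (skelFam Sp.T Sp.p₀) (K + 1))
          (w := fun _ t τ' => Repr172R.weight μ (reprFam Sp.T Sp.p₀ Sp.ρ₀ Sp.hρ₀ Sp.h0 (fun _ _ => 1) (fun _ _ => one_pos)) t τ')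
          (Sp.htr K hK)]
      exact Sp.extractB K t ht hK k hk
    · simp only [if_neg hK] at hk; exact absurd hk (Finset.notMem_empty k)

/-- **N20 AT THE IR-103-2 RECORD GIVEN A DISPLAYED COUNT.**  The priced record's two extraction displays (`extractionLawsA_priced ∕
_B_priced`) plus a COUNT of its quotients over the bad keys of the window in the two-rate currency — `Σ_k Sp.qA K k ≤ V·rq^{K − jhalf K}`,
`Σ_k Sp.qB K k ≤ V·rq^{K − jhalf K}` for `K ≥ Sp.K₀`, `0 ≤ V`, `0 < rq < 1` (HYPOTHESES; the cell's count — on this record's own road it is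
DERIVED from the price sentences `priceA ∕ priceB` inside the pinned `_rel` END, jointly with N19∕N21, not here) — give, for some `K₁ ≥ Sp.K₀`,
`RelWeightBound` at the `K₁`-shifted tower carriers with bad set and weight VERBATIM (§2's currency).  Proof:
`PinnedExtraction.exists_relWeightBound_of_extraction_majorant` (`c = 1∕2`, `T4RenewalChains.half_le_sub_jhalf`), threshold raised to `≥ Sp.K₀`
(`B16HistoryTowerExtractionEnd.relWeightBound_raise`), then `relWeightBound_shift_of_eventually`. [folklore] -/
theorem relWeightBound_of_towerExtractionPriced_count
    (Sp : TowerExtractionPricedDataLWR D C O θv rr d n hn g₀ os cΛ M Φ b₀ p₁ η η' κ κ₂ κᵥ P X 𝒢 μ) {V rq : ℝ}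
    (hV : 0 ≤ V) (hrq0 : 0 < rq) (hrq1 : rq < 1)
    (countA : ∀ K, Sp.K₀ ≤ K →
      ∑ k ∈ badGMems (memA n F.L (Sp.𝒮.reading Sp.T Sp.p₀)) jhalf (HIndex.termSet (skelFam Sp.T Sp.p₀))
          (kmemA n F.L hn (lt_of_lt_of_le (by norm_num) (two_le_L F)) (Sp.𝒮.reading Sp.T Sp.p₀)) K, Sp.qA K k ≤
        V * rq ^ (K - jhalf K))
    (countB : ∀ K, Sp.K₀ ≤ K →
      ∑ k ∈ badGMems (memA n F.L (Sp.𝒮.reading Sp.T Sp.p₀)) jhalf (HIndex.termSet (skelFam Sp.T Sp.p₀))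
          (kmemA n F.L hn (lt_of_lt_of_le (by norm_num) (two_le_L F)) (Sp.𝒮.reading Sp.T Sp.p₀)) K, Sp.qB K k ≤
        V * rq ^ (K - jhalf K)) :
    ∃ K₁, Sp.K₀ ≤ K₁ ∧ RelWeightBound Sp.l₀ (fun K => HIndex.termSet (skelFam Sp.T Sp.p₀) (K₁ + K))
      (fun _ t => Repr172R.weight μ (reprFam Sp.T Sp.p₀ Sp.ρ₀ Sp.hρ₀ Sp.h0 (fun _ _ => 1) (fun _ _ => one_pos)) t)
      (fun K => weightB μ (reprFam Sp.T Sp.p₀ Sp.ρ₀ Sp.hρ₀ Sp.h0 (fun _ _ => 1) (fun _ _ => one_pos)) Sp.trunc (K₁ + K))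
      (fun K t => badOfClass (bstrOf Prod.fst (memA n F.L (Sp.𝒮.reading Sp.T Sp.p₀))) (HIndex.termSet (skelFam Sp.T Sp.p₀))
          (fun K _ => badClasses Prod.fst (memA n F.L (Sp.𝒮.reading Sp.T Sp.p₀)) jhalf (HIndex.termSet (skelFam Sp.T Sp.p₀)) K)
          (K₁ + K) t)
      (fun K => V * rq ^ (K₁ + K - jhalf (K₁ + K))) := by
  have hmajA : ∀ K, ∑ k ∈ (if Sp.K₀ ≤ K then
      badGMems (memA n F.L (Sp.𝒮.reading Sp.T Sp.p₀)) jhalf (HIndex.termSet (skelFam Sp.T Sp.p₀))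
        (kmemA n F.L hn (lt_of_lt_of_le (by norm_num) (two_le_L F)) (Sp.𝒮.reading Sp.T Sp.p₀)) K
      else ∅), Sp.qA K k ≤ V * rq ^ (K - jhalf K) := fun K => by
    by_cases hK : Sp.K₀ ≤ K
    · simp only [if_pos hK]; exact countA K hK
    · simp only [if_neg hK, Finset.sum_empty]; exact mul_nonneg hV (pow_nonneg hrq0.le _)
  have hmajB : ∀ K, ∑ k ∈ (if Sp.K₀ ≤ K then
      badGMems (memA n F.L (Sp.𝒮.reading Sp.T Sp.p₀)) jhalf (HIndex.termSet (skelFam Sp.T Sp.p₀))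
        (kmemA n F.L hn (lt_of_lt_of_le (by norm_num) (two_le_L F)) (Sp.𝒮.reading Sp.T Sp.p₀)) K
      else ∅), Sp.qB K k ≤ V * rq ^ (K - jhalf K) := fun K => by
    by_cases hK : Sp.K₀ ≤ K
    · simp only [if_pos hK]; exact countB K hK
    · simp only [if_neg hK, Finset.sum_empty]; exact mul_nonneg hV (pow_nonneg hrq0.le _)
  obtain ⟨K₀', h⟩ := exists_relWeightBound_of_extraction_majorant (extractionLawsA_priced Sp) (extractionLawsB_priced Sp)
    (fun _ t _ τ => Repr172R.weight_nonneg μ _ t (fun _ _ _ => zero_le_one) τ)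
    (fun K t _ τ => weightB_nonneg μ _ Sp.trunc K t (fun _ _ _ => zero_le_one) τ) hrq0 hrq1 hV one_half_pos
    half_le_sub_jhalf hmajA hmajB
  have hraise := relWeightBound_raise (le_max_left K₀' Sp.K₀)
    (summable_weightMajorant hrq0 hrq1 hV one_half_pos half_le_sub_jhalf) h
    (Bad := fun K t => badOfClass (bstrOf Prod.fst (memA n F.L (Sp.𝒮.reading Sp.T Sp.p₀))) (HIndex.termSet (skelFam Sp.T Sp.p₀))
      (fun K _ => badClasses Prod.fst (memA n F.L (Sp.𝒮.reading Sp.T Sp.p₀)) jhalf (HIndex.termSet (skelFam Sp.T Sp.p₀)) K) K t)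
    fun K t hK => by simp only [if_pos (le_trans (le_max_right _ _) hK)]
  exact relWeightBound_shift_of_eventually ⟨max K₀' Sp.K₀, le_max_right _ _, hraise⟩

end Priced

section Step

variable {F : T4Family} {G : Type*} [GaugeGroup G] [MeasurableSpace G] [HaarData G]
  {D : FiniteEpsData F G} {C : T4PrintedShapeBanking.Consts} {O : PrintedO1s} {θv : ℝ} {rr d n : ℕ} {hn : 0 < n}
  {g₀ : ℕ → ℝ} {os : List (ULoop F)} {cΛ M Φ b₀ : ℝ} {p₁ η η' κ κ₂ κᵥ : ℕ}
  {P : Type} [DecidableEq P] {X : ℕ → ℕ → Type} {𝒢 : (K j : ℕ) → GoodClass (X K j)}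
  [∀ K j, MeasurableSpace (X K j)] {μ : (K j : ℕ) → Measure (X K j)} [∀ K, IsFiniteMeasure (μ K K)]

/-- **N20 ONE STEP DEEPER — AT ne6's IR-104-2 RECORD `TowerExtractionStepDataLWR` (H3^NE7b's display DERIVED from LOCAL CONDITIONAL
STABILITY), GIVEN A DISPLAYED COUNT.**  The record carries, per bad key along its key pattern, `pwA ∕ pwB : PointwiseExtraction …`
([Balaban1989LargeFieldI] (0.1) p. 175, [Balaban1989LargeFieldII] p. 383 — by definition of the regions) and **`lcsA ∕ lcsB : LocCondStability …`**
(THE residual of Bałaban's KIND: the sacrificed action part's conditional expectation `≤ e^{b}` in the history term's own state —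
[Balaban1989LargeFieldI] (0.3)–(0.5) pp. 176–177; NOT print's statement), the step-kernel identities and the key-pattern readings;
`B16HistoryTowerExtractionEnd3.toPriced` turns it into the IR-103-2 record with the DERIVED quotients `exp Σ_{j<K} (bA − aA)` ∕
`exp Σ_{j<K+1} (bB − aB)` and the displays `extractA_of_LCS ∕ extractB_of_LCS`.  With the cell's COUNT displayed AT THOSE DERIVED QUOTIENTS
(binders `countA ∕ countB`): for some `K₁ ≥ Sd.K₀`, `RelWeightBound` at the `K₁`-shifted tower carriers, bad set and weight VERBATIM.  So
N20 ⇐ {LCS per pinned event, step kernels, readings} + {count}; every input a hypothesis; nothing of Bałaban's asserted. [folklore] -/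
theorem relWeightBound_of_towerExtractionStep_count
    (Sd : TowerExtractionStepDataLWR D C O θv rr d n hn g₀ os cΛ M Φ b₀ p₁ η η' κ κ₂ κᵥ P X 𝒢 μ) {V rq : ℝ}
    (hV : 0 ≤ V) (hrq0 : 0 < rq) (hrq1 : rq < 1)
    (countA : ∀ K, Sd.K₀ ≤ K →
      ∑ k ∈ badGMems (memA n F.L (Sd.𝒮.reading Sd.T Sd.p₀)) jhalf (HIndex.termSet (skelFam Sd.T Sd.p₀))
          (kmemA n F.L hn (lt_of_lt_of_le (by norm_num) (two_le_L F)) (Sd.𝒮.reading Sd.T Sd.p₀)) K, (toPriced Sd).qA K k ≤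
        V * rq ^ (K - jhalf K))
    (countB : ∀ K, Sd.K₀ ≤ K →
      ∑ k ∈ badGMems (memA n F.L (Sd.𝒮.reading Sd.T Sd.p₀)) jhalf (HIndex.termSet (skelFam Sd.T Sd.p₀))
          (kmemA n F.L hn (lt_of_lt_of_le (by norm_num) (two_le_L F)) (Sd.𝒮.reading Sd.T Sd.p₀)) K, (toPriced Sd).qB K k ≤
        V * rq ^ (K - jhalf K)) :
    ∃ K₁, Sd.K₀ ≤ K₁ ∧ RelWeightBound Sd.l₀ (fun K => HIndex.termSet (skelFam Sd.T Sd.p₀) (K₁ + K))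
      (fun _ t => Repr172R.weight (fun K => μ K K) (reprFam Sd.T Sd.p₀ Sd.ρ₀ Sd.hρ₀ Sd.h0 (fun _ _ => 1) (fun _ _ => one_pos)) t)
      (fun K => weightB (fun K => μ K K) (reprFam Sd.T Sd.p₀ Sd.ρ₀ Sd.hρ₀ Sd.h0 (fun _ _ => 1) (fun _ _ => one_pos)) Sd.trunc
        (K₁ + K))
      (fun K t => badOfClass (bstrOf Prod.fst (memA n F.L (Sd.𝒮.reading Sd.T Sd.p₀))) (HIndex.termSet (skelFam Sd.T Sd.p₀))
          (fun K _ => badClasses Prod.fst (memA n F.L (Sd.𝒮.reading Sd.T Sd.p₀)) jhalf (HIndex.termSet (skelFam Sd.T Sd.p₀)) K)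
          (K₁ + K) t)
      (fun K => V * rq ^ (K₁ + K - jhalf (K₁ + K))) :=
  relWeightBound_of_towerExtractionPriced_count (toPriced Sd) hV hrq0 hrq1 countA countB

end Step

end Summit.QuantumFields.YangMills.BalabanUVNodes.N20Knit

end
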